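import Literature.Computation.Certificates.PosSemidef
import Mathlib.Data.Rat.Floor

/-!
# Sparse quadratic forms with a VERIFIED Gram-matrix assembly (infrastructure for the torus model of H12⋆)

Route `FreeSplittingCertificates`, crux `StrictSplittingRule` (stmt-AtomisticToContinuum-12560), unit b2b-freesplit-B
(block 2b, PART B).  VALUE = certificate / kernel theorems on a FINITE model — not summit progress.

The finite (torus) model of the joint sitewise LMI (`…TorusModel442.lean`) is a quadratic form in the `192` displacement
coordinates written, exactly as in `CoreJointSiteIneq`, as a long sum of weighted products `c · ℓ(u) · ℓ'(u)` of SPARSE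
linear functionals (relative displacements, co-rotated residuals, bond elongations).  This file provides:

* `LinF N` — sparse linear functionals `List (Fin N × ℚ)` with `LinF.eval`, `LinF.coeff` and
  `LinF.eval_eq_sum_coeff : ℓ.eval u = ∑ i, ℓ.coeff i * u i`; combinators `LinF.add/sub/smul`.
* `evalQ ts u = Σ_{(c,ℓ,ℓ') ∈ ts} c · ℓ(u) · ℓ'(u)` and its SEMANTIC Gram matrix `gramFun ts`
  with `evalQ_eq_quadForm : evalQ ts u = ∑ i j, u i * gramFun ts i j * u j`.
* an EFFICIENT assembly `assemble ts : Vector ℚ (N*N)` by sparse scatter-add, PROVED equal to the semantic matrix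
  (`toMatrix_assemble`), so that `native_decide` can evaluate certificates of forms with ~10⁵ terms.
* `symm` (symmetrisation, quadratic form unchanged) and the glue
  `evalQ_nonneg_of_certDD : A = symm (assemble ts).toMatrix → PSD.IsGramCertDD A d B → 0 ≤ evalQ ts u`
  (the trusted predicate `PSD.IsGramCertDD` of `Literature/Computation/Certificates/PosSemidef.lean`).
* an UNTRUSTED generator `ldlRowsR r` (exact symmetric elimination with dyadic rounding to `r` bits — no digit growth)
  producing approximate factors `(d, B)` for `PSD.IsGramCertDD`; soundness rests only on the trusted check.

Generic in `N`; [folklore] throughout (Gram matrix of a sum of products of linear forms; Cholesky/LDLᵀ with rounding,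
Higham, *Accuracy and Stability of Numerical Algorithms*, Ch. 10).
-/

namespace Summit.AtomisticToContinuum.Crystallization.Theorems.StrictSplittingRuleTorusLMI

open Literature.Computation.Certificates

variable {N : ℕ}

/-! ## Sparse linear functionals -/

/-- A sparse linear functional on `Fin N → ℚ`: a list of (coordinate, coefficient) pairs; repeated coordinates add
up. [folklore] -/
abbrev LinF (N : ℕ) := List (Fin N × ℚ)

/-- A weighted product term `(c, ℓ, ℓ')`, read as `c · ℓ(u) · ℓ'(u)`. [folklore] -/
abbrev Term (N : ℕ) := ℚ × LinF N × LinF N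

namespace LinF

/-- Value of a sparse functional at `u`. [folklore] -/
def eval (ℓ : LinF N) (u : Fin N → ℚ) : ℚ := (ℓ.map fun p => p.2 * u p.1).sum

/-- Total coefficient of coordinate `i`. [folklore] -/
def coeff (ℓ : LinF N) (i : Fin N) : ℚ := (ℓ.map fun p => if p.1 = i then p.2 else 0).sum

/-- Sum of two functionals (concatenation). [folklore] -/
def add (ℓ ℓ' : LinF N) : LinF N := ℓ ++ ℓ'

/-- Scalar multiple. [folklore] -/
def smul (c : ℚ) (ℓ : LinF N) : LinF N := ℓ.map fun p => (p.1, c * p.2)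

/-- Difference. [folklore] -/
def sub (ℓ ℓ' : LinF N) : LinF N := ℓ ++ smul (-1) ℓ'

/-- The coordinate functional `u ↦ u i`. [folklore] -/
def coord (i : Fin N) : LinF N := [(i, 1)]

/-- The empty functional is zero. [folklore] -/
@[simp] theorem eval_nil (u : Fin N → ℚ) : eval ([] : LinF N) u = 0 := rfl

/-- Evaluation, cons case. [folklore] -/
@[simp] theorem eval_cons (p : Fin N × ℚ) (ℓ : LinF N) (u : Fin N → ℚ) :
    eval (p :: ℓ) u = p.2 * u p.1 + eval ℓ u := by
  simp [eval]

/-- Evaluation is additive under concatenation. [folklore] -/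
@[simp] theorem eval_append (ℓ ℓ' : LinF N) (u : Fin N → ℚ) : eval (ℓ ++ ℓ') u = eval ℓ u + eval ℓ' u := by
  simp [eval, List.map_append, List.sum_append]

/-- `eval (add ℓ ℓ') = eval ℓ + eval ℓ'`. [folklore] -/
@[simp] theorem eval_add (ℓ ℓ' : LinF N) (u : Fin N → ℚ) : eval (add ℓ ℓ') u = eval ℓ u + eval ℓ' u :=
  eval_append ℓ ℓ' u

/-- `eval (smul c ℓ) = c · eval ℓ`. [folklore] -/
@[simp] theorem eval_smul (c : ℚ) (ℓ : LinF N) (u : Fin N → ℚ) : eval (smul c ℓ) u = c * eval ℓ u := by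
  induction ℓ with
  | nil => simp [smul]
  | cons p ℓ ih =>
    simp only [smul, List.map_cons] at ih ⊢
    rw [eval_cons, eval_cons, ih]
    ring

/-- `eval (sub ℓ ℓ') = eval ℓ − eval ℓ'`. [folklore] -/
@[simp] theorem eval_sub (ℓ ℓ' : LinF N) (u : Fin N → ℚ) : eval (sub ℓ ℓ') u = eval ℓ u - eval ℓ' u := by
  simp [sub, sub_eq_add_neg]

/-- `eval (coord i) u = u i`. [folklore] -/
@[simp] theorem eval_coord (i : Fin N) (u : Fin N → ℚ) : eval (coord i) u = u i := by
  simp [coord]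

/-- Coefficients of the empty functional vanish. [folklore] -/
@[simp] theorem coeff_nil (i : Fin N) : coeff ([] : LinF N) i = 0 := rfl

/-- Coefficients, cons case. [folklore] -/
@[simp] theorem coeff_cons (p : Fin N × ℚ) (ℓ : LinF N) (i : Fin N) :
    coeff (p :: ℓ) i = (if p.1 = i then p.2 else 0) + coeff ℓ i := by
  simp [coeff]

/-- **A sparse functional is the linear form of its coefficient vector.** [folklore] -/
theorem eval_eq_sum_coeff (ℓ : LinF N) (u : Fin N → ℚ) : eval ℓ u = ∑ i, coeff ℓ i * u i := by
  induction ℓ with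
  | nil => simp
  | cons p ℓ ih =>
    rw [eval_cons, ih]
    simp only [coeff_cons, add_mul, Finset.sum_add_distrib, ite_mul, zero_mul, Finset.sum_ite_eq,
      Finset.mem_univ, if_true]

end LinF

/-! ## Quadratic forms as term lists -/

/-- `evalQ ts u = Σ_{(c, ℓ, ℓ') ∈ ts} c · ℓ(u) · ℓ'(u)`. [folklore] -/
def evalQ (ts : List (Term N)) (u : Fin N → ℚ) : ℚ :=
  (ts.map fun t => t.1 * t.2.1.eval u * t.2.2.eval u).sum

/-- The empty term list is the zero form. [folklore] -/
@[simp] theorem evalQ_nil (u : Fin N → ℚ) : evalQ ([] : List (Term N)) u = 0 := rfl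

/-- `evalQ`, cons case. [folklore] -/
@[simp] theorem evalQ_cons (t : Term N) (ts : List (Term N)) (u : Fin N → ℚ) :
    evalQ (t :: ts) u = t.1 * t.2.1.eval u * t.2.2.eval u + evalQ ts u := by
  simp [evalQ]

/-- `evalQ` is additive under concatenation of term lists. [folklore] -/
@[simp] theorem evalQ_append (ts ts' : List (Term N)) (u : Fin N → ℚ) :
    evalQ (ts ++ ts') u = evalQ ts u + evalQ ts' u := by
  simp [evalQ, List.map_append, List.sum_append]

/-- The SEMANTIC Gram matrix of a term list: `G i j = Σ c · coeff ℓ i · coeff ℓ' j`. [folklore] -/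
def gramFun (ts : List (Term N)) : Matrix (Fin N) (Fin N) ℚ :=
  fun i j => (ts.map fun t => t.1 * t.2.1.coeff i * t.2.2.coeff j).sum

/-- Gram matrix of the empty list. [folklore] -/
@[simp] theorem gramFun_nil : gramFun ([] : List (Term N)) = 0 := by
  ext i j; simp [gramFun]

/-- Gram matrix, cons case (rank-one update). [folklore] -/
theorem gramFun_cons (t : Term N) (ts : List (Term N)) :
    gramFun (t :: ts) = fun i j => t.1 * t.2.1.coeff i * t.2.2.coeff j + gramFun ts i j := by
  ext i j; simp [gramFun]

/-- One weighted product as a quadratic form of its (rank-one) Gram matrix. [folklore] -/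
theorem term_quadForm (c : ℚ) (ℓ ℓ' : LinF N) (u : Fin N → ℚ) :
    c * ℓ.eval u * ℓ'.eval u = ∑ i, ∑ j, u i * (c * ℓ.coeff i * ℓ'.coeff j) * u j := by
  rw [LinF.eval_eq_sum_coeff, LinF.eval_eq_sum_coeff]
  simp_rw [Finset.mul_sum, Finset.sum_mul]
  rw [Finset.sum_comm]
  refine Finset.sum_congr rfl fun i _ => Finset.sum_congr rfl fun j _ => ?_
  ring

/-- **The quadratic form of a term list is that of its Gram matrix**:
`evalQ ts u = ∑ i j, u i · gramFun ts i j · u j`. [folklore] -/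
theorem evalQ_eq_quadForm (ts : List (Term N)) (u : Fin N → ℚ) :
    evalQ ts u = ∑ i, ∑ j, u i * gramFun ts i j * u j := by
  induction ts with
  | nil => simp
  | cons t ts ih =>
    rw [evalQ_cons, ih, gramFun_cons, term_quadForm, ← Finset.sum_add_distrib]
    refine Finset.sum_congr rfl fun i _ => ?_
    rw [← Finset.sum_add_distrib]
    refine Finset.sum_congr rfl fun j _ => ?_
    ring

/-! ## Efficient assembly by sparse scatter-add into a flat vector (proved correct) -/

/-- Row-major flat index of `(i, j)`. [folklore] -/
def flatIdx (i j : Fin N) : Fin (N * N) :=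
  ⟨i.val * N + j.val, by
    have hi := i.isLt; have hj := j.isLt
    calc i.val * N + j.val < i.val * N + N := by omega
      _ = (i.val + 1) * N := by ring
      _ ≤ N * N := by nlinarith⟩

/-- The flat index is injective. [folklore] -/
theorem flatIdx_inj {i j i' j' : Fin N} (h : flatIdx i j = flatIdx i' j') : i = i' ∧ j = j' := by
  have h1 : j.val + i.val * N = j'.val + i'.val * N := by
    have := congrArg Fin.val h
    simp only [flatIdx] at this
    omega
  have hj := j.isLt; have hj' := j'.isLt
  have hN : 0 < N := Nat.lt_of_le_of_lt (Nat.zero_le _) hj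
  have hmod := congrArg (· % N) h1
  simp only [Nat.add_mul_mod_self_right, Nat.mod_eq_of_lt hj, Nat.mod_eq_of_lt hj'] at hmod
  have hdiv := congrArg (· / N) h1
  simp only [Nat.add_mul_div_right _ _ hN, Nat.div_eq_of_lt hj, Nat.div_eq_of_lt hj', Nat.zero_add] at hdiv
  exact ⟨Fin.ext hdiv, Fin.ext hmod⟩

/-- The accumulator: a flat vector of `N*N` rationals. [folklore] -/
abbrev Acc (N : ℕ) := Vector ℚ (N * N)

namespace Acc

/-- Read the accumulator as a matrix. [folklore] -/
def toMatrix (a : Acc N) : Matrix (Fin N) (Fin N) ℚ := fun i j => a[(flatIdx i j).val]'(flatIdx i j).isLt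

/-- Add `v` at position `(i, j)`. [folklore] -/
def add1 (a : Acc N) (i j : Fin N) (v : ℚ) : Acc N :=
  a.set (flatIdx i j).val (a[(flatIdx i j).val]'(flatIdx i j).isLt + v) (flatIdx i j).isLt

/-- `add1` adds `v` at `(i, j)` and nothing elsewhere. [folklore] -/
theorem toMatrix_add1 (a : Acc N) (i j : Fin N) (v : ℚ) :
    (a.add1 i j v).toMatrix = fun i' j' => a.toMatrix i' j' + if i = i' ∧ j = j' then v else 0 := by
  ext i' j'
  simp only [toMatrix, add1]
  rw [Vector.getElem_set]
  by_cases h : flatIdx i j = flatIdx i' j'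
  · obtain ⟨rfl, rfl⟩ := flatIdx_inj h
    simp
  · have h' : (flatIdx i j).val ≠ (flatIdx i' j').val := fun e => h (Fin.ext e)
    have h'' : ¬ (i = i' ∧ j = j') := by rintro ⟨rfl, rfl⟩; exact h rfl
    simp [h', h'']

/-- Scatter-add the weighted outer product `c · ℓ ⊗ ℓ'`. [folklore] -/
def addOuter (a : Acc N) (c : ℚ) (ℓ ℓ' : LinF N) : Acc N :=
  ℓ.foldl (fun a p => ℓ'.foldl (fun a q => a.add1 p.1 q.1 (c * p.2 * q.2)) a) a

/-- Inner scatter loop: adds `x · coeff ℓ' j` along row `i`. [folklore] -/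
theorem toMatrix_inner (a : Acc N) (i : Fin N) (x : ℚ) (ℓ' : LinF N) :
    (ℓ'.foldl (fun a q => a.add1 i q.1 (x * q.2)) a).toMatrix =
      fun i' j' => a.toMatrix i' j' + if i = i' then x * ℓ'.coeff j' else 0 := by
  induction ℓ' generalizing a with
  | nil => ext i' j'; simp
  | cons q ℓ' ih =>
    rw [List.foldl_cons, ih, toMatrix_add1]
    ext i' j'
    simp only [LinF.coeff_cons]
    by_cases hi : i = i'
    · by_cases hj : q.1 = j'
      · rw [if_pos ⟨hi, hj⟩, if_pos hi, if_pos hi, if_pos hj]; ring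
      · rw [if_neg (fun h => hj h.2), if_pos hi, if_pos hi, if_neg hj]; ring
    · rw [if_neg (fun h => hi h.1), if_neg hi, if_neg hi]; ring

/-- `addOuter` adds the weighted outer product `c · coeff ℓ i · coeff ℓ' j`. [folklore] -/
theorem toMatrix_addOuter (a : Acc N) (c : ℚ) (ℓ ℓ' : LinF N) :
    (a.addOuter c ℓ ℓ').toMatrix = fun i j => a.toMatrix i j + c * ℓ.coeff i * ℓ'.coeff j := by
  unfold addOuter
  induction ℓ generalizing a with
  | nil => ext i j; simp
  | cons p ℓ ih =>
    rw [List.foldl_cons, ih, toMatrix_inner a p.1 (c * p.2) ℓ']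
    ext i j
    simp only [LinF.coeff_cons]
    by_cases hi : p.1 = i
    · rw [if_pos hi, if_pos hi]; ring
    · rw [if_neg hi, if_neg hi]; ring

end Acc

/-- **Efficient assembly** of the Gram matrix of a term list (one pass, sparse scatter-add). [folklore] -/
def assemble (ts : List (Term N)) : Acc N :=
  ts.foldl (fun a t => a.addOuter t.1 t.2.1 t.2.2) (Vector.replicate (N * N) 0)

/-- Folding `addOuter` over a term list adds its semantic Gram matrix. [folklore] -/
theorem toMatrix_foldl (ts : List (Term N)) (a : Acc N) :
    (ts.foldl (fun a t => a.addOuter t.1 t.2.1 t.2.2) a).toMatrix = fun i j => a.toMatrix i j + gramFun ts i j := by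
  induction ts generalizing a with
  | nil => ext i j; simp
  | cons t ts ih =>
    rw [List.foldl_cons, ih, Acc.toMatrix_addOuter, gramFun_cons]
    ext i j
    ring

/-- **The assembled matrix IS the semantic Gram matrix.** [folklore] -/
theorem toMatrix_assemble (ts : List (Term N)) : (assemble ts).toMatrix = gramFun ts := by
  rw [assemble, toMatrix_foldl]
  ext i j
  simp [Acc.toMatrix]

/-! ## Symmetrisation and the certificate glue -/

/-- Symmetric part. [folklore] -/
def symm (M : Matrix (Fin N) (Fin N) ℚ) : Matrix (Fin N) (Fin N) ℚ := fun i j => (M i j + M j i) / 2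

/-- Symmetrisation does not change the quadratic form. [folklore] -/
theorem quadForm_symm (M : Matrix (Fin N) (Fin N) ℚ) (u : Fin N → ℚ) :
    ∑ i, ∑ j, u i * symm M i j * u j = ∑ i, ∑ j, u i * M i j * u j := by
  have hT : ∑ i, ∑ j, u i * M j i * u j = ∑ i, ∑ j, u i * M i j * u j := by
    rw [Finset.sum_comm]
    exact Finset.sum_congr rfl fun i _ => Finset.sum_congr rfl fun j _ => by ring
  have h2 : ∀ i j, u i * symm M i j * u j = (1 / 2) * (u i * M i j * u j) + (1 / 2) * (u i * M j i * u j) := by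
    intro i j; simp only [symm]; ring
  simp_rw [h2, Finset.sum_add_distrib, ← Finset.mul_sum, hT]
  ring

/-- **Glue**: a rounded Gram certificate (`PSD.IsGramCertDD`, trusted predicate of `PosSemidef.lean`) of the
symmetrised assembled matrix makes the term-list quadratic form nonnegative everywhere. [folklore] -/
theorem evalQ_nonneg_of_certDD {ts : List (Term N)} {m : ℕ} {A : Matrix (Fin N) (Fin N) ℚ}
    {d : Fin m → ℚ} {B : Matrix (Fin m) (Fin N) ℚ} (hA : A = symm (assemble ts).toMatrix)
    (h : PSD.IsGramCertDD A d B) (u : Fin N → ℚ) : 0 ≤ evalQ ts u := by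
  have h0 := h.quadForm_nonneg (R := ℚ) u
  simp only [Rat.cast_id] at h0
  rw [hA, quadForm_symm, toMatrix_assemble, ← evalQ_eq_quadForm] at h0
  exact h0

/-! ## Untrusted generator: symmetric elimination with dyadic rounding -/

/-- Round to `r` fractional bits: `round(x · 2^r) / 2^r`. [folklore] -/
def rnd (r : ℕ) (x : ℚ) : ℚ := (⌊x * 2 ^ r + 1 / 2⌋ : ℚ) / 2 ^ r

/-- One rounded Schur-complement step (`lT` = the rounded factor row `b/a`): rows of `C − a·l lᵀ`, rounded.
[folklore] -/
def schurRowsR (r : ℕ) (a : ℚ) (lT : List ℚ) (rest : List (List ℚ)) : List (List ℚ) :=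
  List.zipWith (fun (row : List ℚ) (li : ℚ) => List.zipWith (fun cij lj => rnd r (cij - a * li * lj)) row.tail lT)
    rest lT

/-- **Rounded `LDLᵀ`** on row lists (fuel, rows): pivots and unit upper-triangular factor rows, every computed entry
rounded to `r` bits (no digit growth).  A nonpositive pivot is recorded as `0` with factor row `eₖ`.  UNTRUSTED: its
output is only ever fed to the trusted check `PSD.IsGramCertDD`. [folklore] -/
def ldlRowsR (r : ℕ) : ℕ → List (List ℚ) → List ℚ × List (List ℚ)
  | 0, _ => ([], [])
  | _ + 1, [] => ([], [])
  | k + 1, row :: rest =>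
    let a := row.headD 0
    let bT := row.tail
    if 0 < a then
      let lT := bT.map fun x => rnd r (x / a)
      let p := ldlRowsR r k (schurRowsR r a lT rest)
      (a :: p.1, (1 :: lT) :: p.2.map (List.cons 0))
    else
      let p := ldlRowsR r k (rest.map List.tail)
      (0 :: p.1, (1 :: bT.map fun _ => 0) :: p.2.map (List.cons 0))

/-- Array-backed `Fin n`-vector (O(1) access for `native_decide`). [folklore] -/
def vecOfArray (n : ℕ) (a : Array ℚ) : Fin n → ℚ := fun i => a.getD i.val 0

/-- Array-backed matrix (O(1) access for `native_decide`). [folklore] -/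
def matrixOfArrays (m n : ℕ) (a : Array (Array ℚ)) : Matrix (Fin m) (Fin n) ℚ :=
  fun i j => (a.getD i.val #[]).getD j.val 0

/-- Rows of a `Fin`-matrix as arrays. [folklore] -/
def arraysOf {m n : ℕ} (A : Matrix (Fin m) (Fin n) ℚ) : Array (Array ℚ) :=
  Array.ofFn fun i : Fin m => Array.ofFn fun j : Fin n => A i j

/-- The rounded factor `(d, B)` of `A − c·1` as arrays: the data for `PSD.IsGramCertDD A d B` (whose residual is then
`c·1 +` rounding noise, diagonally dominant when the noise row sums stay below `c`). [folklore] -/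
def certArrays {n : ℕ} (r : ℕ) (c : ℚ) (A : Matrix (Fin n) (Fin n) ℚ) : Array ℚ × Array (Array ℚ) :=
  let rows := List.ofFn fun i : Fin n => List.ofFn fun j : Fin n => A i j - if i = j then c else 0
  let p := ldlRowsR r n rows
  (p.1.toArray, (p.2.map List.toArray).toArray)

end Summit.AtomisticToContinuum.Crystallization.Theorems.StrictSplittingRuleTorusLMI
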